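import Summits.CriticalPhenomena.SAWScalingLimit.Theorems.SAWTotalPositivityCriticalBubbleBoundJoinArcs
import Literature.Probability.RandomPlanarGeometry.SAWBridges

/-!
# Hammond's unfolding of polygons with many global join plaquettes, I: preparations
(line `docking-census-joining`, stub `gjoins_esStep_ne_side`, infrastructure for stub `gjoins_unfold`)

Crux `stmt-CriticalPhenomena-7117`
(`Summit.CriticalPhenomena.SAWScalingLimit.Theses.SAWTotalPositivity.CriticalBubbleBound`), line
`docking-census-joining`, JOIN-MASS programme (lead c6). This is the first of three files formalising
the multi-valued map of Hammond's Proposition 4.5 (a lex-rooted polygon with `m` pairwise non-touching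
global join plaquettes unfolds injectively into an `(N + 2m + 6)`-step bridge; stub `gjoins_unfold` in
`…JoinUnfold`). Contents:

* registered stub `gjoins_esStep_ne_side` — the step of `χ` arriving at `ES = χ (esIdx)` (the lowest
  rightmost vertex) is neither horizontal side of a global join plaquette; consequently (`head_cross`)
  the head arc `χ[0, esIdx]` crosses the other side of a plaquette crossed by a tail step at a step
  ending STRICTLY before `ES`, so detour vertices are never tail vertices; `tail_unique`,
  `sides_unique`, `corner_ne` (non-touching plaquettes have disjoint corners);
* generic walk bookkeeping used by the map (namespace `Join.Unfold`): `toFun` (a vertex list as an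
  element of `Zd.saws`), the four-step vertical padding `pad`, the transposition `swapXY`.

Sources: A. Hammond, *An upper bound on the number of self-avoiding polygons via joining*, Ann. Probab.
46 (2018) = arXiv:1808.09032, Lemma 4.7 and the proof of Proposition 4.5; N. Madras, G. Slade, *The
Self-Avoiding Walk* (1993), §3.1. Elementary combinatorics ([folklore]).
-/

noncomputable section

open Literature.Probability.LatticeModels
open Literature.Probability.RandomPlanarGeometry Literature.Probability.RandomPlanarGeometry.SAW
open scoped BigOperators
open Summit.CriticalPhenomena.SAWScalingLimit.Theorems.CriticalBubbleBound.Negative (e₀)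
open Summit.CriticalPhenomena.SAWScalingLimit.Theorems.CriticalBubbleBound.Docking

namespace Summit.CriticalPhenomena.SAWScalingLimit.Theorems.CriticalBubbleBound.Join

variable {N : ℕ} {χ : ℕ → Site 2} {κ : Finset (Site 2)}

namespace Unfold

/-! ## Steps, sides and corners -/

/-- Distinct steps of a self-avoiding walk are distinct edges. [folklore] -/
theorem step_inj (hχ : χ ∈ Zd.sawFun 2 N e₀) {i₁ i₂ : ℕ} (h₁ : i₁ < N) (h₂ : i₂ < N)
    (h : s(χ i₁, χ (i₁ + 1)) = s(χ i₂, χ (i₂ + 1))) : i₁ = i₂ := by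
  have hinj := (Zd.mem_sawFun.1 hχ).2.2.2
  rcases Sym2.eq_iff.1 h with ⟨h, -⟩ | ⟨h, h'⟩
  · exact hinj (show i₁ ≤ N by omega) (show i₂ ≤ N by omega) h
  · have e₁ := hinj (show i₁ ≤ N by omega) (show i₂ + 1 ≤ N by omega) h
    have e₂ := hinj (show i₁ + 1 ≤ N by omega) (show i₂ ≤ N by omega) h'
    omega

/-- A horizontal unit segment is determined by its left endpoint. [folklore] -/
theorem hseg_inj {a b : Site 2} (h : s(a, a + e₀) = s(b, b + e₀)) : a = b := by
  rcases Sym2.eq_iff.1 h with ⟨h, -⟩ | ⟨h1, h2⟩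
  · exact h
  · have := congrFun h2 0
    rw [h1] at this
    simp only [Pi.add_apply, e₀_e₁_apply.1] at this
    omega

/-- Corners of two non-touching plaquettes are distinct. [folklore] -/
theorem corner_ne {q q' d d' : Site 2} (ht : 2 ≤ |q 0 - q' 0| ∨ 2 ≤ |q 1 - q' 1|)
    (hd : (d 0 = q 0 ∨ d 0 = q 0 + 1) ∧ (d 1 = q 1 ∨ d 1 = q 1 + 1))
    (hd' : (d' 0 = q' 0 ∨ d' 0 = q' 0 + 1) ∧ (d' 1 = q' 1 ∨ d' 1 = q' 1 + 1)) : d ≠ d' := by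
  intro h
  have h0 := congrFun h 0
  have h1 := congrFun h 1
  rw [le_abs', le_abs'] at ht
  omega

/-- The four corners of the plaquette at `q`, in coordinates. [folklore] -/
theorem corner_of_mem {q d : Site 2} (h : d = q ∨ d = q + e₀ ∨ d = q + e₁ ∨ d = q + e₀ + e₁) :
    (d 0 = q 0 ∨ d 0 = q 0 + 1) ∧ (d 1 = q 1 ∨ d 1 = q 1 + 1) := by
  rcases h with rfl | rfl | rfl | rfl <;>
    simp [Pi.add_apply, e₀_e₁_apply.1, e₀_e₁_apply.2.1, e₀_e₁_apply.2.2.1, e₀_e₁_apply.2.2.2]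

/-- Two non-touching plaquettes of `κ` sharing a horizontal side are equal. [folklore] -/
theorem sides_unique (hnt : ∀ q ∈ κ, ∀ q' ∈ κ, q ≠ q' → 2 ≤ |q 0 - q' 0| ∨ 2 ≤ |q 1 - q' 1|)
    {q q' : Site 2} (hq : q ∈ κ) (hq' : q' ∈ κ)
    {e : Sym2 (Site 2)} (he : e = s(q, q + e₀) ∨ e = s(q + e₁, q + e₀ + e₁))
    (he' : e = s(q', q' + e₀) ∨ e = s(q' + e₁, q' + e₀ + e₁)) : q = q' := by
  by_contra hne
  have ht := hnt q hq q' hq' hne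
  rw [add_right_comm q e₀ e₁] at he
  rw [add_right_comm q' e₀ e₁] at he'
  have key : ∀ a b : Site 2, (a = q ∨ a = q + e₁) → (b = q' ∨ b = q' + e₁) →
      s(a, a + e₀) = s(b, b + e₀) → False := by
    intro a b ha hb hab
    refine corner_ne ht (corner_of_mem ?_) (corner_of_mem ?_) (hseg_inj hab)
    · rcases ha with h | h
      · exact Or.inl h
      · exact Or.inr (Or.inr (Or.inl h))
    · rcases hb with h | h
      · exact Or.inl h
      · exact Or.inr (Or.inr (Or.inl h))
  rcases he with rfl | rfl <;> rcases he' with h | h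
  · exact key _ _ (Or.inl rfl) (Or.inl rfl) h
  · exact key _ _ (Or.inl rfl) (Or.inr rfl) h
  · exact key _ _ (Or.inr rfl) (Or.inl rfl) h
  · exact key _ _ (Or.inr rfl) (Or.inr rfl) h

end Unfold

/-! ## The step into `ES` is not a side of a global join plaquette -/

/-- **Stub `gjoins_esStep_ne_side`.** For a lex-rooted polygon and a global join plaquette at `q`, the step of `χ` arriving at
`ES = χ (esIdx)` is neither horizontal side of the plaquette: arriving from the right is
impossible (`ES` is rightmost); arriving along the upper side from the left puts the lower side's
endpoint `q + e₀` below `ES` in the rightmost column; arriving along the lower side from the left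
forces the next step to be the right side `{q+e₀, q+e₀+e₁}` of the plaquette (the other
neighbours of `ES` being excluded), which is not an edge. [folklore] -/
theorem gjoins_esStep_ne_side : ∀ (N : ℕ) (χ : ℕ → Site 2), χ ∈ lexRooted N → 3 ≤ N → ∀ q ∈ gjoins N χ, s(χ (esIdx N χ - 1), χ (esIdx N χ)) ≠ s(q, q + e₀) ∧ s(χ (esIdx N χ - 1), χ (esIdx N χ)) ≠ s(q + e₁, q + e₀ + e₁) := by
  intro N χ hχ hN q hq
  obtain ⟨-, hJ, -⟩ := mem_gjoins.1 hq
  have hsaw := lexRooted_subset N hχ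
  obtain ⟨-, hend, hadj, hinj⟩ := Zd.mem_sawFun.1 hsaw
  obtain ⟨hjN, hjES⟩ := esIdx_spec N χ
  have hES0 : χ (esIdx N χ) 0 = xmax N χ := by rw [hjES]; rfl
  have hES1 : χ (esIdx N χ) 1 = esRow N χ := by rw [hjES]; rfl
  have hcol : ∀ v ∈ verts N χ, v 0 = xmax N χ → esRow N χ ≤ v 1 := fun v hv hv0 =>
    esRow_le (mem_rightCol.2 ⟨hv, hv0⟩)
  have hxle : ∀ v ∈ verts N χ, v 0 ≤ xmax N χ := by
    intro v hv
    obtain ⟨i, hi, rfl⟩ := Finset.mem_image.1 hv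
    exact apply_le_xmax χ (Nat.lt_succ_iff.1 (Finset.mem_range.1 hi))
  have key : ∀ a : Site 2, s(χ (esIdx N χ - 1), χ (esIdx N χ)) = s(a, a + e₀) →
      χ (esIdx N χ - 1) = a ∧ χ (esIdx N χ) = a + e₀ := by
    intro a h
    rcases Sym2.eq_iff.1 h with ⟨h1, h2⟩ | ⟨h1, h2⟩
    · exact ⟨h1, h2⟩
    · exfalso
      have := hxle _ (apply_mem_verts χ (show esIdx N χ - 1 ≤ N by omega))
      rw [h1, Pi.add_apply, e₀_e₁_apply.1, ← h2, hES0] at this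
      omega
  refine ⟨fun h => ?_, fun h => ?_⟩
  · obtain ⟨h1, h2⟩ := key q h
    rcases lt_or_eq_of_le hjN with hjN' | hjN'
    · rcases adj_cases (hadj _ hjN') with hv | hv | hv | hv
      · have := hxle _ (apply_mem_verts χ (show esIdx N χ + 1 ≤ N by omega))
        rw [hv, Pi.add_apply, e₀_e₁_apply.1, hES0] at this
        omega
      · have hq' : χ (esIdx N χ + 1) = χ (esIdx N χ - 1) := by
          rw [hv, h2, h1, add_sub_cancel_right]
        have := hinj (show esIdx N χ + 1 ≤ N by omega) (show esIdx N χ - 1 ≤ N by omega) hq'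
        omega
      · refine hJ.2.2.2 ?_
        rw [← h2, ← hv]
        exact mk_step_mem_pedges χ hjN'
      · have h3 := hcol _ (apply_mem_verts χ (show esIdx N χ + 1 ≤ N by omega))
          (by rw [hv, Pi.sub_apply, e₀_e₁_apply.2.2.1, sub_zero, hES0])
        rw [hv, Pi.sub_apply, e₀_e₁_apply.2.2.2, hES1] at h3
        omega
    · have hq0 : q = 0 := by
        have h3 : χ (esIdx N χ) = e₀ := by rw [hjN']; exact hend N le_rfl
        rw [h2] at h3
        simpa using congrArg (· - e₀) h3
      refine (rootEdge_ne_of_isJoinPlaq N χ hχ (by omega) q hJ).1 ?_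
      rw [hq0, zero_add]
      rfl
  · rw [add_right_comm q e₀ e₁] at h
    obtain ⟨-, h2⟩ := key (q + e₁) h
    have hv : q + e₀ ∈ verts N χ := exists_mem_pedges_iff.1 ⟨_, hJ.1, Sym2.mem_mk_right _ _⟩
    have h0' := congrFun h2 0
    have h1' := congrFun h2 1
    simp only [Pi.add_apply, e₀_e₁_apply.1, e₀_e₁_apply.2.1, e₀_e₁_apply.2.2.1,
      e₀_e₁_apply.2.2.2] at h0' h1'
    have h3 := hcol _ hv (by rw [Pi.add_apply, e₀_e₁_apply.1, ← hES0, h0']; ring)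
    rw [Pi.add_apply, e₀_e₁_apply.2.1, ← hES1, h1'] at h3
    omega

namespace Unfold

/-- For a tail step (index in `[esIdx, N)`) across one horizontal side of a global join plaquette
of `κ`, the head arc crosses the OTHER side at a step ending strictly before `ES`. [folklore] -/
theorem head_cross (hχ : χ ∈ lexRooted N) (hN : 3 ≤ N) {q : Site 2} (hq : q ∈ gjoins N χ)
    {i : ℕ} (hji : esIdx N χ ≤ i) (hiN : i < N) :
    (s(χ i, χ (i + 1)) = s(q, q + e₀) →
      ∃ i', i' + 1 < esIdx N χ ∧ s(χ i', χ (i' + 1)) = s(q + e₁, q + e₀ + e₁)) ∧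
    (s(χ i, χ (i + 1)) = s(q + e₁, q + e₀ + e₁) →
      ∃ i', i' + 1 < esIdx N χ ∧ s(χ i', χ (i' + 1)) = s(q, q + e₀)) := by
  obtain ⟨⟨i', hi', h⟩, -⟩ := gjoins_arcs N χ hχ hN q hq
  have hsaw := lexRooted_subset N hχ
  obtain ⟨hA1, hA2⟩ := gjoins_esStep_ne_side N χ hχ hN q hq
  have hne : ∀ {e : Sym2 (Site 2)}, s(χ i, χ (i + 1)) = e → s(χ i', χ (i' + 1)) ≠ e :=
    fun h₁ h₂ => by have := step_inj hsaw hiN (by omega) (h₁.trans h₂.symm); omega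
  have hlt : ∀ {e : Sym2 (Site 2)}, s(χ i', χ (i' + 1)) = e →
      s(χ (esIdx N χ - 1), χ (esIdx N χ)) ≠ e → i' + 1 < esIdx N χ := by
    intro e h₁ h₂
    by_contra hcon
    obtain rfl : i' = esIdx N χ - 1 := by omega
    rw [Nat.sub_add_cancel (by omega : 1 ≤ esIdx N χ)] at h₁
    exact h₂ h₁
  refine ⟨fun hlo => ?_, fun hhi => ?_⟩
  · rcases h with h | h
    · exact absurd h (hne hlo)
    · exact ⟨i', hlt h hA2, h⟩
  · rcases h with h | h
    · exact ⟨i', hlt h hA1, h⟩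
    · exact absurd h (hne hhi)

/-- The tail arc crosses a global join plaquette at ONE step. [folklore] -/
theorem tail_unique (hχ : χ ∈ lexRooted N) (hN : 3 ≤ N) {q : Site 2} (hq : q ∈ gjoins N χ)
    {i₁ i₂ : ℕ} (hj₁ : esIdx N χ ≤ i₁) (h₁ : i₁ < N) (hj₂ : esIdx N χ ≤ i₂) (h₂ : i₂ < N)
    (hs₁ : s(χ i₁, χ (i₁ + 1)) = s(q, q + e₀) ∨ s(χ i₁, χ (i₁ + 1)) = s(q + e₁, q + e₀ + e₁))
    (hs₂ : s(χ i₂, χ (i₂ + 1)) = s(q, q + e₀) ∨ s(χ i₂, χ (i₂ + 1)) = s(q + e₁, q + e₀ + e₁)) :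
    i₁ = i₂ := by
  obtain ⟨⟨i', hi', h⟩, -⟩ := gjoins_arcs N χ hχ hN q hq
  have S := fun {a b : ℕ} (ha : a < N) (hb : b < N)
    (h : s(χ a, χ (a + 1)) = s(χ b, χ (b + 1))) => step_inj (lexRooted_subset N hχ) ha hb h
  rcases hs₁ with h₁' | h₁' <;> rcases hs₂ with h₂' | h₂'
  · exact S h₁ h₂ (h₁'.trans h₂'.symm)
  · rcases h with h | h
    · have := S (by omega) h₁ (h.trans h₁'.symm); omega
    · have := S (by omega) h₂ (h.trans h₂'.symm); omega
  · rcases h with h | h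
    · have := S (by omega) h₂ (h.trans h₂'.symm); omega
    · have := S (by omega) h₁ (h.trans h₁'.symm); omega
  · exact S h₁ h₂ (h₁'.trans h₂'.symm)

/-! ## Generic bookkeeping for the unfolding: vertex lists as walks -/

/-- A vertex list as a function `ℕ → Site 2`, frozen at its last vertex. [folklore] -/
def toFun (L : List (Site 2)) : ℕ → Site 2 := fun i => L.getD (min i (L.length - 1)) 0

/-- Values of `toFun` inside the list. [folklore] -/
theorem toFun_apply {L : List (Site 2)} {i : ℕ} (hi : i < L.length) : toFun L i = L[i] := by
  unfold toFun
  rw [min_eq_left (by omega), List.getD_eq_getElem _ _ hi]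

/-- Values of `toFun` after the list: the last vertex. [folklore] -/
theorem toFun_apply_of_le {L : List (Site 2)} {i : ℕ} (hL : 0 < L.length) (hi : L.length - 1 ≤ i) :
    toFun L i = L[L.length - 1] := by
  unfold toFun
  rw [min_eq_right hi, List.getD_eq_getElem]

/-- Every value of `toFun L` is a vertex of `L`. [folklore] -/
theorem toFun_mem {L : List (Site 2)} (hL : 0 < L.length) (i : ℕ) : toFun L i ∈ L := by
  unfold toFun
  rw [List.getD_eq_getElem _ _ (by omega)]
  exact List.getElem_mem _

/-- `toFun` is injective on lists of a given length. [folklore] -/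
theorem toFun_inj {L L' : List (Site 2)} (h : toFun L = toFun L') (hl : L.length = L'.length) :
    L = L' :=
  List.ext_getElem hl fun i h₁ h₂ => by rw [← toFun_apply h₁, ← toFun_apply h₂, h]

/-- A self-avoiding lattice path from `0`, as a function, is an element of `Zd.saws`. [folklore] -/
theorem toFun_mem_saws {L : List (Site 2)} (hL : 0 < L.length)
    (hc : List.IsChain (fun a b => (zdGraph 2).Adj a b) L) (hn : L.Nodup) (h0 : L.head? = some 0) :
    toFun L ∈ Zd.saws 2 (L.length - 1) := by
  refine Zd.mem_saws.2 ⟨?_, fun i hi => ?_, fun i hi => ?_, fun i hi i' hi' h => ?_⟩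
  · rw [toFun_apply hL]
    rw [List.head?_eq_getElem?, List.getElem?_eq_getElem hL, Option.some.injEq] at h0
    exact h0
  · rw [toFun_apply_of_le hL hi, toFun_apply_of_le hL le_rfl]
  · rw [toFun_apply (by omega), toFun_apply (by omega)]
    exact List.isChain_iff_getElem.1 hc i (by omega)
  · simp only [Set.mem_setOf_eq] at hi hi'
    rw [toFun_apply (by omega), toFun_apply (by omega)] at h
    exact hn.getElem_inj_iff.1 h

/-! ## Generic bookkeeping for the unfolding: padding and transposition -/

/-- PADDING: four vertical steps `0, e₁, 2e₁, 3e₁` and then `W + 4e₁` (the start becomes the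
unique lowest vertex). [folklore] -/
def pad (W : ℕ → Site 2) : ℕ → Site 2 :=
  fun i => if i < 4 then (i : ℤ) • e₁ else W (i - 4) + (4 : ℤ) • e₁

/-- Ordinates of the padding. [folklore] -/
theorem pad_apply_one_of_lt (W : ℕ → Site 2) {i : ℕ} (hi : i < 4) : pad W i 1 = i := by
  simp [pad, hi, e₀_e₁_apply.2.2.2]

/-- Values after the padding. [folklore] -/
theorem pad_apply_of_le (W : ℕ → Site 2) {i : ℕ} (hi : 4 ≤ i) :
    pad W i = W (i - 4) + (4 : ℤ) • e₁ := by
  simp [pad, Nat.not_lt.2 hi]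

/-- Ordinates after the padding. [folklore] -/
theorem pad_apply_one_of_le (W : ℕ → Site 2) {i : ℕ} (hi : 4 ≤ i) :
    pad W i 1 = W (i - 4) 1 + 4 := by
  rw [pad_apply_of_le W hi]
  simp [e₀_e₁_apply.2.2.2]

/-- Padding a self-avoiding walk of the upper half-plane gives a self-avoiding walk. [folklore] -/
theorem pad_mem_saws {n : ℕ} {W : ℕ → Site 2} (hW : W ∈ Zd.saws 2 n) (hnn : ∀ i, 0 ≤ W i 1) :
    pad W ∈ Zd.saws 2 (n + 4) := by
  obtain ⟨h0, hend, hadj, hinj⟩ := Zd.mem_saws.1 hW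
  have hstep : ∀ i : ℕ, (zdGraph 2).Adj ((i : ℤ) • e₁) (((i + 1 : ℕ) : ℤ) • e₁) := fun i => by
    rw [Nat.cast_succ, add_smul, one_smul]
    exact adj_add_e₁ _
  have hge : ∀ j, 4 ≤ j → 4 ≤ pad W j 1 := fun j hj => by
    rw [pad_apply_one_of_le W hj]
    linarith [hnn (j - 4)]
  refine Zd.mem_saws.2 ⟨by simp [pad], fun i hi => ?_, fun i hi => ?_, fun i hi i' hi' h => ?_⟩
  · rw [pad_apply_of_le W (by omega), pad_apply_of_le W (by omega), hend (i - 4) (by omega),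
      Nat.add_sub_cancel]
  · rcases Nat.lt_or_ge (i + 1) 4 with h4 | h4
    · simp only [pad, if_pos h4, if_pos (show i < 4 by omega)]
      exact hstep i
    · rcases Nat.lt_or_ge i 4 with h4' | h4'
      · obtain rfl : i = 3 := by omega
        rw [pad_apply_of_le W le_rfl, show 3 + 1 - 4 = 0 from rfl, h0, zero_add]
        simp only [pad, if_pos (show 3 < 4 by norm_num)]
        exact hstep 3
      · rw [pad_apply_of_le W h4', pad_apply_of_le W h4, Zd.zdGraph_adj_add_right,
          show i + 1 - 4 = i - 4 + 1 by omega]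
        exact hadj (i - 4) (by omega)
  · simp only [Set.mem_setOf_eq] at hi hi'
    rcases Nat.lt_or_ge i 4 with h4 | h4 <;> rcases Nat.lt_or_ge i' 4 with h4' | h4'
    · have h1 := congrFun h 1
      rw [pad_apply_one_of_lt W h4, pad_apply_one_of_lt W h4'] at h1
      exact_mod_cast h1
    · have h1 := congrFun h 1
      rw [pad_apply_one_of_lt W h4] at h1
      have := hge i' h4'
      omega
    · have h1 := congrFun h 1
      rw [pad_apply_one_of_lt W h4'] at h1
      have := hge i h4
      omega
    · rw [pad_apply_of_le W h4, pad_apply_of_le W h4', add_left_inj] at h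
      have := hinj (show i - 4 ≤ n by omega) (show i' - 4 ≤ n by omega) h
      omega

/-- Padding is injective. [folklore] -/
theorem pad_injective {W W' : ℕ → Site 2} (h : pad W = pad W') : W = W' := by
  funext i
  have := congrFun h (i + 4)
  rwa [pad_apply_of_le W (by omega), pad_apply_of_le W' (by omega), add_left_inj,
    Nat.add_sub_cancel] at this

/-- TRANSPOSITION of the two coordinates (bridges are defined with respect to coordinate `0`).
[folklore] -/
def swapXY (ω : ℕ → Site 2) : ℕ → Site 2 := fun i => ![ω i 1, ω i 0]

/-- Transposing a self-avoiding walk gives a self-avoiding walk. [folklore] -/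
theorem swapXY_mem_saws {n : ℕ} {ω : ℕ → Site 2} (hω : ω ∈ Zd.saws 2 n) :
    swapXY ω ∈ Zd.saws 2 n := by
  obtain ⟨h0, hend, hadj, hinj⟩ := Zd.mem_saws.1 hω
  -- the transposition is a graph automorphism of `ℤ²`
  have hsw : ∀ {a b : Site 2}, (zdGraph 2).Adj a b →
      (zdGraph 2).Adj (![a 1, a 0] : Site 2) ![b 1, b 0] := by
    intro a b h
    rw [zdGraph_adj_iff] at h ⊢
    obtain ⟨i, h | h⟩ := h
    · refine ⟨Equiv.swap 0 1 i, Or.inl ?_⟩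
      rw [h]
      funext j
      fin_cases i <;> fin_cases j <;> simp
    · refine ⟨Equiv.swap 0 1 i, Or.inr ?_⟩
      rw [h]
      funext j
      fin_cases i <;> fin_cases j <;> simp
  refine Zd.mem_saws.2 ⟨?_, fun i hi => ?_, fun i hi => hsw (hadj i hi), fun i hi i' hi' h => ?_⟩
  · simp only [swapXY, h0, Pi.zero_apply]
    funext j
    fin_cases j <;> rfl
  · simp only [swapXY, hend i hi]
  · refine hinj hi hi' ?_
    have ha := congrFun h 0
    have hb := congrFun h 1
    simp only [swapXY, Matrix.cons_val_zero, Matrix.cons_val_one] at ha hb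
    funext j
    fin_cases j
    · exact hb
    · exact ha

/-- The transposition is injective. [folklore] -/
theorem swapXY_injective {ω ω' : ℕ → Site 2} (h : swapXY ω = swapXY ω') : ω = ω' := by
  funext i j
  have ha := congrFun (congrFun h i) 0
  have hb := congrFun (congrFun h i) 1
  simp only [swapXY, Matrix.cons_val_zero, Matrix.cons_val_one] at ha hb
  fin_cases j
  · exact hb
  · exact ha

end Unfold

end Summit.CriticalPhenomena.SAWScalingLimit.Theorems.CriticalBubbleBound.Join

end
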